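import Mathlib
import Summits.NavierStokesRegularity.NavierStokesRegularity.Theorems.FilamentSkeletonRssSkeletonJ1RLiaDerivPartnerWindow
import Summits.NavierStokesRegularity.NavierStokesRegularity.Theorems.FilamentSkeletonRssSkeletonJ1RLiaPartnerReference
import Summits.NavierStokesRegularity.NavierStokesRegularity.Theorems.FilamentSkeletonRssMatchedKernelDirectionalDeriv

/-!
# Crux `SkeletonJ1R` (stmt-NavierStokesRegularity-23610) · line `streamline_kantorovich_R` · toward stub F2-d (`LiaDefectDerivBL`, v7), brick P2′:
# the DERIVATIVE-KERNEL mismatch of ONE PARTNER OF THE LIA REFERENCE against its datum line, at an arbitrary point and direction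

Hand `leafhand-ns-filamentskeletonrs-1` (gen 0), `--supports stmt-NavierStokesRegularity-23610 --as helper`.  MODEL rung, NEGATIVE side of the ladder:
kernel calculus for a HYPOTHETICAL filament-type blow-up skeleton; nothing here is a claim about Navier–Stokes regularity; the stub and the crux stay OPEN.

`IsLiaReference.partnerDerivStrand_sub_le` — the derivative analogue of P2 (`…LiaPartnerReference.IsLiaReference.partnerStrand_sub_le`): for THE
local-induction reference `x`, a partner `k` with the linear curvature envelope `‖x_k″σ‖ ≤ ε₀ + ε₁|σ|` and a global tilt `‖x_k′ − t_k‖ ≤ θ₁ ≤ 1/10`, a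
point `y` at perpendicular distance `≥ a > 0` from the datum line `k` (foot parameter `s = ⟪y − w_k, t_k⟫`, `10θ₁|s| ≤ a`), a direction `P`, a core
constant `q > 0` and any `L₀ > 0`:
`‖∫ G_q(y − x_kσ, x_k′σ, P) dσ − ∫ G_q(y − L_kσ, t_k, P) dσ‖ ≤ (7‖P‖/a)·(2Lk·A₀ + πA₁/a + 416πθ₁/Lk)`, `Lk = 2|s| + L₀`, `A₀ = 51ε₀/a + 104ε₁`,
`A₁ = 50ε₀s²/a + 100ε₁|s|³/a + 2ε₀|s| + 4ε₁s²`, where `G_q(w,a,v) = (−3⟪w,v⟫((‖w‖²+q)^{5/2})⁻¹)•a×w + ((‖w‖²+q)^{3/2})⁻¹•a×v` — brick P1′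
(`norm_integral_derivKernel_sub_le_of_envelopes`) fed with the reference envelopes exactly as P2 feeds P1; integrability of both derivative strands from the
landed matched-kernel toolkit (`MatchedKernel.matchedBiotSavart_directionalDeriv`), the datum line being the `C^∞` unit-speed curve `σ ↦ w_k + σ•t_k`
(`hasDerivAt_datumLine`, `deriv_datumLine`, `contDiff_datumLine`, `norm_datumLine_ge`).
-/

set_option linter.dupNamespace false -- `NavierStokesRegularity.NavierStokesRegularity` path/namespace repetition is the tree convention

noncomputable section

namespace Summit.NavierStokesRegularity.NavierStokesRegularity.Theorems.SkeletonJ1RFrame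

open Set Function Filter Real Topology MeasureTheory
open Literature.Analysis.FluidPDE
open Summit.NavierStokesRegularity.NavierStokesRegularity.Theorems.SkeletonJ1RMismatchTools (norm_sub_line_sq)
open Summit.NavierStokesRegularity.NavierStokesRegularity.Theorems.SkeletonJ1RLiaSelf (norm_deriv_sub_deriv_le_on norm_taylorTwo_le_of_curvature
  norm_taylorTwo_le_of_osc abs_le_of_mem_uIcc)
open Summit.NavierStokesRegularity.NavierStokesRegularity.Theorems.SkeletonJ1RSlipTools (chord_arc_of_osc)
open Summit.NavierStokesRegularity.NavierStokesRegularity.Theorems.MatchedKernel (matchedBiotSavart_directionalDeriv)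
open scoped InnerProductSpace BigOperators

/-! ## §1 The datum line as a unit-speed `C^∞` curve -/

/-- The datum line is `σ ↦ w_k + σ • t_k`. [folklore] -/
theorem datumLine_eq_fun {N : ℕ} (Γ : ℝ) (p t : Fin N → EuclideanSpace ℝ (Fin 3)) (s₀ : Fin N → ℝ) (k : Fin N) :
    datumLine Γ p t s₀ k = fun σ => waistPt Γ p t s₀ k + σ • t k := rfl

/-- The datum line has velocity `t_k` everywhere. [folklore] -/
theorem hasDerivAt_datumLine {N : ℕ} (Γ : ℝ) (p t : Fin N → EuclideanSpace ℝ (Fin 3)) (s₀ : Fin N → ℝ) (k : Fin N) (σ : ℝ) :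
    HasDerivAt (datumLine Γ p t s₀ k) (t k) σ := by
  have h := ((hasDerivAt_id σ).smul_const (t k)).const_add (waistPt Γ p t s₀ k)
  rw [one_smul] at h
  rw [datumLine_eq_fun]
  exact h

/-- `deriv` of the datum line is `t_k`. [folklore] -/
theorem deriv_datumLine {N : ℕ} (Γ : ℝ) (p t : Fin N → EuclideanSpace ℝ (Fin 3)) (s₀ : Fin N → ℝ) (k : Fin N) (σ : ℝ) :
    deriv (datumLine Γ p t s₀ k) σ = t k :=
  (hasDerivAt_datumLine Γ p t s₀ k σ).deriv

/-- The datum line is smooth. [folklore] -/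
theorem contDiff_datumLine {N : ℕ} (Γ : ℝ) (p t : Fin N → EuclideanSpace ℝ (Fin 3)) (s₀ : Fin N → ℝ) (k : Fin N) {n : WithTop ℕ∞} :
    ContDiff ℝ n (datumLine Γ p t s₀ k) := by
  rw [datumLine_eq_fun]
  exact contDiff_const.add (contDiff_id.smul contDiff_const)

/-- Linear growth of the datum line: `|σ| − ‖w_k‖ ≤ ‖L_k σ‖` (`‖t_k‖ = 1`). [folklore] -/
theorem norm_datumLine_ge {N : ℕ} (Γ : ℝ) (p t : Fin N → EuclideanSpace ℝ (Fin 3)) (s₀ : Fin N → ℝ) (k : Fin N) (ht : ‖t k‖ = 1)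
    (σ : ℝ) : 1 * |σ| - ‖waistPt Γ p t s₀ k‖ ≤ ‖datumLine Γ p t s₀ k σ‖ := by
  have h1 : ‖σ • t k‖ = |σ| := by rw [norm_smul, Real.norm_eq_abs, ht, mul_one]
  have h2 : ‖σ • t k‖ ≤ ‖waistPt Γ p t s₀ k + σ • t k‖ + ‖waistPt Γ p t s₀ k‖ := by
    calc ‖σ • t k‖ = ‖(waistPt Γ p t s₀ k + σ • t k) - waistPt Γ p t s₀ k‖ := by congr 1; abel
      _ ≤ ‖waistPt Γ p t s₀ k + σ • t k‖ + ‖waistPt Γ p t s₀ k‖ := norm_sub_le _ _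
  show 1 * |σ| - ‖waistPt Γ p t s₀ k‖ ≤ ‖waistPt Γ p t s₀ k + σ • t k‖
  linarith

/-- **Integrability of the derivative strand of the datum line** at every point `y`, direction `P`, core `q > 0`. [folklore] -/
theorem integrable_derivKernel_datumLine {N : ℕ} (Γ : ℝ) (p t : Fin N → EuclideanSpace ℝ (Fin 3)) (s₀ : Fin N → ℝ) (k : Fin N)
    (ht : ‖t k‖ = 1) {q : ℝ} (hq : 0 < q) (y P : EuclideanSpace ℝ (Fin 3)) :
    Integrable fun σ : ℝ => (-3 * ⟪y - datumLine Γ p t s₀ k σ, P⟫_ℝ *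
        ((‖y - datumLine Γ p t s₀ k σ‖ ^ 2 + q) ^ (5 / 2 : ℝ))⁻¹) • cross (t k) (y - datumLine Γ p t s₀ k σ) +
      ((‖y - datumLine Γ p t s₀ k σ‖ ^ 2 + q) ^ (3 / 2 : ℝ))⁻¹ • cross (t k) P := by
  have hL1 : ∀ u, ‖deriv (datumLine Γ p t s₀ k) u‖ ≤ 1 := fun u => by rw [deriv_datumLine, ht]
  have h := (matchedBiotSavart_directionalDeriv (m := fun _ => q) hq (fun _ => le_rfl) continuous_const one_pos
    ((contDiff_datumLine Γ p t s₀ k).of_le le_top) hL1 (norm_datumLine_ge Γ p t s₀ k ht) y P).1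
  refine h.congr (Eventually.of_forall fun σ => ?_)
  simp only [deriv_datumLine]

variable {N : ℕ} {Γ Rb : ℝ} {p t : Fin N → EuclideanSpace ℝ (Fin 3)} {γ : Fin N → ℝ} {α : ℝ} {s₀ : Fin N → ℝ}
  {x : Fin N → ℝ → EuclideanSpace ℝ (Fin 3)}

/-- **Integrability of the derivative strand of a reference filament** (unit speed, tilt `≤ θ₁ ≤ 1/10` against a unit vector). [folklore] -/
theorem IsLiaReference.integrable_derivKernel_strand (hx : IsLiaReference Γ Rb p t γ α s₀ x) (k : Fin N)
    {θ₁ : ℝ} (hθ₁ : θ₁ ≤ 1 / 10) (htilt : ∀ σ, ‖deriv (x k) σ - t k‖ ≤ θ₁) {q : ℝ} (hq : 0 < q) (y P : EuclideanSpace ℝ (Fin 3)) :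
    Integrable fun σ : ℝ => (-3 * ⟪y - x k σ, P⟫_ℝ * ((‖y - x k σ‖ ^ 2 + q) ^ (5 / 2 : ℝ))⁻¹) • cross (deriv (x k) σ) (y - x k σ) +
      ((‖y - x k σ‖ ^ 2 + q) ^ (3 / 2 : ℝ))⁻¹ • cross (deriv (x k) σ) P := by
  obtain ⟨hC2, hunit, h0, -, -⟩ := hx k
  have hθ₁0 : 0 ≤ θ₁ := (norm_nonneg _).trans (htilt 0)
  have hosc : ∀ u v, ‖deriv (x k) u - deriv (x k) v‖ ≤ 2 * θ₁ := fun u v => by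
    calc ‖deriv (x k) u - deriv (x k) v‖ = ‖(deriv (x k) u - t k) - (deriv (x k) v - t k)‖ := by congr 1; abel
      _ ≤ ‖deriv (x k) u - t k‖ + ‖deriv (x k) v - t k‖ := norm_sub_le _ _
      _ ≤ 2 * θ₁ := by linarith [htilt u, htilt v]
  have hgrow : ∀ u, (1 / 2 : ℝ) * |u| - ‖waistPt Γ p t s₀ k‖ ≤ ‖x k u‖ := fun u => by
    have h := chord_arc_of_osc (hC2.of_le (by norm_num)) hunit hosc u 0
    rw [sub_zero, h0] at h
    have h2 : (1 / 2 : ℝ) * |u| ≤ (1 - (2 * θ₁) ^ 2 / 2) * |u| := mul_le_mul_of_nonneg_right (by nlinarith) (abs_nonneg u)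
    have h3 : ‖x k u - waistPt Γ p t s₀ k‖ ≤ ‖x k u‖ + ‖waistPt Γ p t s₀ k‖ := norm_sub_le _ _
    linarith
  exact (matchedBiotSavart_directionalDeriv (m := fun _ => q) hq (fun _ => le_rfl) continuous_const (by norm_num : (0:ℝ) < 1 / 2)
    (hC2.of_le (by norm_num)) (fun u => (hunit u).le) hgrow y P).1

/-! ## §2 Brick P2′ -/

set_option maxHeartbeats 800000 in
/-- **One partner of the LIA reference against its datum line — DERIVATIVE KERNEL — at an arbitrary point and direction** (module docstring). [folklore] -/
theorem IsLiaReference.partnerDerivStrand_sub_le (hx : IsLiaReference Γ Rb p t γ α s₀ x) (ht : ∀ k, ‖t k‖ = 1) (k : Fin N)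
    {ε₀ ε₁ θ₁ : ℝ} (hε₀ : 0 ≤ ε₀) (hε₁ : 0 ≤ ε₁) (henv : ∀ σ, ‖deriv (deriv (x k)) σ‖ ≤ ε₀ + ε₁ * |σ|) (hθ₁0 : 0 ≤ θ₁)
    (hθ₁ : θ₁ ≤ 1 / 10) (htilt : ∀ σ, ‖deriv (x k) σ - t k‖ ≤ θ₁) {q : ℝ} (hq : 0 < q) (y P : EuclideanSpace ℝ (Fin 3)) {a L₀ : ℝ}
    (ha : 0 < a) (hL₀ : 0 < L₀) (hay : a ^ 2 ≤ ‖y - waistPt Γ p t s₀ k‖ ^ 2 - (inner ℝ (y - waistPt Γ p t s₀ k) (t k)) ^ 2)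
    (hθs : 10 * θ₁ * |inner ℝ (y - waistPt Γ p t s₀ k) (t k)| ≤ a) :
    ‖(∫ σ : ℝ, ((-3 * ⟪y - x k σ, P⟫_ℝ * ((‖y - x k σ‖ ^ 2 + q) ^ (5 / 2 : ℝ))⁻¹) • cross (deriv (x k) σ) (y - x k σ) +
          ((‖y - x k σ‖ ^ 2 + q) ^ (3 / 2 : ℝ))⁻¹ • cross (deriv (x k) σ) P)) -
        ∫ σ : ℝ, ((-3 * ⟪y - datumLine Γ p t s₀ k σ, P⟫_ℝ * ((‖y - datumLine Γ p t s₀ k σ‖ ^ 2 + q) ^ (5 / 2 : ℝ))⁻¹) •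
            cross (t k) (y - datumLine Γ p t s₀ k σ) +
          ((‖y - datumLine Γ p t s₀ k σ‖ ^ 2 + q) ^ (3 / 2 : ℝ))⁻¹ • cross (t k) P)‖ ≤
      7 * ‖P‖ / a * (2 * (2 * |inner ℝ (y - waistPt Γ p t s₀ k) (t k)| + L₀) * (50 * ε₀ / a + 100 * ε₁ + ε₀ / a + 4 * ε₁) +
        (50 * ε₀ * (inner ℝ (y - waistPt Γ p t s₀ k) (t k)) ^ 2 / a + 100 * ε₁ * |inner ℝ (y - waistPt Γ p t s₀ k) (t k)| ^ 3 / a +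
          2 * ε₀ * |inner ℝ (y - waistPt Γ p t s₀ k) (t k)| + 4 * ε₁ * (inner ℝ (y - waistPt Γ p t s₀ k) (t k)) ^ 2) * (Real.pi / a) +
        416 * θ₁ * (Real.pi / (2 * |inner ℝ (y - waistPt Γ p t s₀ k) (t k)| + L₀))) := by
  obtain ⟨hC2, hunit, h0, h0', -⟩ := hx k
  set w := waistPt Γ p t s₀ k with hw
  set s : ℝ := inner ℝ (y - w) (t k) with hs
  set L : ℝ → EuclideanSpace ℝ (Fin 3) := datumLine Γ p t s₀ k with hL
  have hLσ : ∀ σ, L σ = w + σ • t k := fun σ => rfl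
  have hLx : ∀ σ, L σ = x k 0 + σ • deriv (x k) 0 := fun σ => by rw [hLσ, h0, h0']
  have hLk : 0 < 2 * |s| + L₀ := by positivity
  have hLs : 2 * |s| ≤ 2 * |s| + L₀ := by linarith
  -- the line hypothesis (equality for a straight line)
  have hline : ∀ σ, a ^ 2 + (σ - s) ^ 2 ≤ ‖y - L σ‖ ^ 2 := fun σ => by
    rw [hLσ, norm_sub_line_sq y w (t k) (ht k) σ]; linarith
  -- envelopes of the partner, shot from the common waist
  have hseg : ∀ σ, ∀ q' ∈ uIcc 0 σ, ‖deriv (deriv (x k)) q'‖ ≤ ε₀ + ε₁ * |σ| := fun σ q' hq' => by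
    have h := (abs_le_of_mem_uIcc hq').2
    rw [abs_zero, zero_add, sub_zero] at h
    exact (henv q').trans (by nlinarith)
  have hdisp : ∀ σ, ‖x k σ - L σ‖ ≤ ε₀ * σ ^ 2 + ε₁ * |σ| ^ 3 := fun σ => by
    have h := norm_taylorTwo_le_of_curvature hC2 (hseg σ)
    rw [sub_zero] at h
    rw [hLx, ← sub_sub]
    calc ‖x k σ - x k 0 - σ • deriv (x k) 0‖ ≤ (ε₀ + ε₁ * |σ|) * σ ^ 2 := h
      _ = ε₀ * σ ^ 2 + ε₁ * |σ| ^ 3 := by rw [← sq_abs σ]; ring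
  have hdispθ : ∀ σ, ‖x k σ - L σ‖ ≤ θ₁ * |σ| := fun σ => by
    have h := norm_taylorTwo_le_of_osc hC2 (τ := 0) (σ := σ) (θ := θ₁) fun q' _ => by rw [h0']; exact htilt q'
    rw [sub_zero] at h
    rw [hLx, ← sub_sub]; exact h
  have htilt' : ∀ σ, ‖deriv (x k) σ - t k‖ ≤ ε₀ * |σ| + ε₁ * σ ^ 2 := fun σ => by
    have h := norm_deriv_sub_deriv_le_on hC2 (hseg σ)
    rw [sub_zero, h0'] at h
    calc ‖deriv (x k) σ - t k‖ ≤ (ε₀ + ε₁ * |σ|) * |σ| := h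
      _ = ε₀ * |σ| + ε₁ * σ ^ 2 := by rw [← sq_abs σ]; ring
  -- smallness of the displacement against the distance
  have hsmall : ∀ σ, ‖x k σ - L σ‖ ≤ ‖y - L σ‖ / 5 := fun σ => by
    have hr2 := hline σ
    have hr0 : 0 ≤ ‖y - L σ‖ := norm_nonneg _
    have har : a ≤ ‖y - L σ‖ := by nlinarith [sq_nonneg (σ - s), sq_nonneg (‖y - L σ‖ - a)]
    have hus : |σ - s| ≤ ‖y - L σ‖ := by
      have : |σ - s| ^ 2 ≤ ‖y - L σ‖ ^ 2 := by rw [sq_abs]; nlinarith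
      nlinarith [abs_nonneg (σ - s), sq_nonneg (‖y - L σ‖ - |σ - s|)]
    have hσle : |σ| ≤ |σ - s| + |s| := by
      calc |σ| = |(σ - s) + s| := by rw [sub_add_cancel]
        _ ≤ |σ - s| + |s| := abs_add_le _ _
    calc ‖x k σ - L σ‖ ≤ θ₁ * |σ| := hdispθ σ
      _ ≤ θ₁ * |σ - s| + θ₁ * |s| := by nlinarith
      _ ≤ ‖y - L σ‖ / 10 + a / 10 := by nlinarith
      _ ≤ ‖y - L σ‖ / 5 := by linarith
  -- integrability of both derivative strands
  have hintA := hx.integrable_derivKernel_strand k hθ₁ htilt hq y P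
  have hintB := integrable_derivKernel_datumLine Γ p t s₀ k (ht k) hq y P
  -- brick P1′
  have h := norm_integral_derivKernel_sub_le_of_envelopes (P := P) hq ha hε₀ hε₁ hε₀ hε₁ hθ₁0 (ht k) hLk hLs hline hdisp hdispθ htilt'
    htilt hsmall hintA hintB
  rw [← integral_sub hintA hintB]
  simpa only [hL] using h

end Summit.NavierStokesRegularity.NavierStokesRegularity.Theorems.SkeletonJ1RFrame

end
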